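import Summits.Parity.GeneralizedHardyLittlewood.Theorems.GreenTaoLevelTwoGITwoCyclicInversePhaseLipschitz
import Literature.NumberTheory.Sieve.LinearEquationsInPrimesLevelTwoInputs

/-!
# Route `GreenTaoLevelTwo`, crux `GITwo` (stmt-Parity-21275), line `birth`, stub `stub_cyclicInverse`:
# circle nilsequences (GT08a arXiv Example 62 and the "linear" half of Lemma 69)

Sixty-second helper file toward the XL stub `stub_cyclicInverse` (B. Green, T. Tao, *An inverse
theorem for the Gowers `U³(G)` norm*, arXiv:math/0503014, Thm. 68 = PEMS 51 (2008) Thm. 12.8).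
Block E16 (arXiv §12): the circle nilflow (Example 62, "`T_gⁿ(x) = x + nα`") realises every
Lipschitz function of `{αn}` as a `1`-bounded Lipschitz nilsequence; in the tree the circle member
of the Heisenberg class is `Nilmanifold.circle.ofLE _ : Nilmanifold 2` (`InHeisClass.circle`), whose
points are those of `AddCircle 1 = ℝ/ℤ` and whose metric is the quotient metric
(`Nilmanifold.circle_dist_eq`).  Def-free statements, complex-valued functions (cf.
`…TensorProduct`), orbits indexed by `n ∈ ℤ` as in the stub:

* `exists_circle_realisation` — for `Ψ : ℝ/ℤ → ℂ` `1`-bounded and `M`-Lipschitz and `θ, x₀ ∈ ℝ`: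
  `Φ, g, p₀` on the circle nilmanifold with `Φ(gⁿ p₀) = Ψ(x₀ + nθ)` (`n ∈ ℤ`), `Φ` `1`-bounded and
  `M`-Lipschitz for the nilmanifold metric;
* `norm_periodic_lift_sub_le` — a `1`-periodic `L`-Lipschitz `ψ : ℝ → ℂ` descends to an
  `L`-Lipschitz function on `ℝ/ℤ` (`Function.Periodic.lift`);
* `exists_circle_character` — the characters `n ↦ e(x₀ + nθ)` are `1`-bounded `2π`-Lipschitz
  circle nilsequences (arXiv Lemma 69, "`F(x,y) = χ(x)e(sx)e(y)`", the factor `e(y)`).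

References: [GreenTao2008U3Inverse] arXiv:math/0503014, §12, Example 62 and Lemma 69.
-/

noncomputable section

namespace Summit.Parity.GeneralizedHardyLittlewood.GreenTaoLevelTwoGITwoCyclicInverse

open Literature.NumberTheory.Sieve

/-- **Circle nilsequences (arXiv Example 62).**  Every `1`-bounded `M`-Lipschitz `Ψ : ℝ/ℤ → ℂ` and
every rotation `θ` with base point `x₀` give a `1`-bounded `M`-Lipschitz function `Φ` on the circle
nilmanifold `Nilmanifold.circle.ofLE h` with `Φ(gⁿ p₀) = Ψ(x₀ + nθ)` for all `n ∈ ℤ`.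
[cite: GreenTao2008U3Inverse, §12, Example 62] -/
theorem exists_circle_realisation (Ψ : AddCircle (1 : ℝ) → ℂ) {M : ℝ} (hb : ∀ a, ‖Ψ a‖ ≤ 1)
    (hL : ∀ a b, ‖Ψ a - Ψ b‖ ≤ M * dist a b) (θ x₀ : ℝ) (h12 : 1 ≤ 2) :
    ∃ (Φ : (Nilmanifold.circle.ofLE h12).G ⧸ (Nilmanifold.circle.ofLE h12).Γ → ℂ)
      (g : (Nilmanifold.circle.ofLE h12).G)
      (p₀ : (Nilmanifold.circle.ofLE h12).G ⧸ (Nilmanifold.circle.ofLE h12).Γ),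
      (∀ y, ‖Φ y‖ ≤ 1) ∧ (∀ y z, ‖Φ y - Φ z‖ ≤ M * (Nilmanifold.circle.ofLE h12).dist y z) ∧
      ∀ n : ℤ, Φ (g ^ n • p₀) = Ψ ((x₀ + n * θ : ℝ) : AddCircle (1 : ℝ)) := by
  refine ⟨fun y => Ψ y, Multiplicative.ofAdd θ,
    (QuotientGroup.mk (Multiplicative.ofAdd x₀) : Nilmanifold.circle.G ⧸ Nilmanifold.circle.Γ),
    fun y => hb _, fun y z => hL _ _, fun n => ?_⟩
  show Ψ _ = Ψ _
  congr 1
  show (QuotientGroup.mk ((Multiplicative.ofAdd θ) ^ n * Multiplicative.ofAdd x₀) :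
      Nilmanifold.circle.G ⧸ Nilmanifold.circle.Γ) = _
  rw [← ofAdd_zsmul, ← ofAdd_add, zsmul_eq_mul, add_comm]
  rfl

/-- **Periodic Lipschitz functions descend to the circle**: if `ψ : ℝ → ℂ` is `1`-periodic and
`‖ψ t − ψ u‖ ≤ L|t − u|`, then `‖ψ̄ a − ψ̄ b‖ ≤ L · dist a b` on `ℝ/ℤ` for the descended function
`ψ̄ = Function.Periodic.lift`. [folklore] -/
theorem norm_periodic_lift_sub_le {ψ : ℝ → ℂ} (hper : Function.Periodic ψ 1) {L : ℝ}
    (hL : ∀ t u : ℝ, ‖ψ t - ψ u‖ ≤ L * |t - u|) (a b : AddCircle (1 : ℝ)) :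
    ‖hper.lift a - hper.lift b‖ ≤ L * dist a b := by
  obtain ⟨x, rfl⟩ := QuotientAddGroup.mk_surjective a
  obtain ⟨y, rfl⟩ := QuotientAddGroup.mk_surjective b
  -- the lift of `b` nearest to `x`
  set t : ℝ := (y - x) - round (y - x) with ht
  have hyt : ((y : ℝ) : AddCircle (1 : ℝ)) = (((x + t : ℝ)) : AddCircle (1 : ℝ)) := by
    rw [ht, show x + (y - x - round (y - x)) = y - round (y - x) by ring, AddCircle.coe_sub]
    have : ((round (y - x) : ℝ) : AddCircle (1 : ℝ)) = 0 := by
      rw [AddCircle.coe_eq_zero_iff]; exact ⟨round (y - x), by simp⟩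
    rw [this, sub_zero]
  have hdist : dist ((x : ℝ) : AddCircle (1 : ℝ)) ((y : ℝ) : AddCircle (1 : ℝ)) = |t| := by
    rw [dist_comm, dist_eq_norm, ← AddCircle.coe_sub, UnitAddCircle.norm_eq, ht]
  change ‖hper.lift (QuotientAddGroup.mk x) - hper.lift (QuotientAddGroup.mk y)‖ ≤ _
  have e1 : hper.lift (QuotientAddGroup.mk x : AddCircle (1 : ℝ)) = ψ x := hper.lift_coe x
  have e2 : hper.lift (QuotientAddGroup.mk y : AddCircle (1 : ℝ)) = ψ (x + t) := by
    have : (QuotientAddGroup.mk y : AddCircle (1 : ℝ)) = ((x + t : ℝ) : AddCircle (1 : ℝ)) := hyt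
    rw [this]; exact hper.lift_coe (x + t)
  rw [e1, e2, hdist]
  refine (hL x (x + t)).trans (le_of_eq ?_)
  rw [show x - (x + t) = -t by ring, abs_neg]

/-- **Characters are circle nilsequences (arXiv Lemma 69, the factor `e(y)`).**  For `θ, x₀ ∈ ℝ`
there are a `1`-bounded `2π`-Lipschitz `Φ` on the circle nilmanifold and `g, p₀` with
`Φ(gⁿ p₀) = e(x₀ + nθ)` for all `n ∈ ℤ`. [cite: GreenTao2008U3Inverse, §12, Lemma 69] -/
theorem exists_circle_character (θ x₀ : ℝ) (h12 : 1 ≤ 2) :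
    ∃ (Φ : (Nilmanifold.circle.ofLE h12).G ⧸ (Nilmanifold.circle.ofLE h12).Γ → ℂ)
      (g : (Nilmanifold.circle.ofLE h12).G)
      (p₀ : (Nilmanifold.circle.ofLE h12).G ⧸ (Nilmanifold.circle.ofLE h12).Γ),
      (∀ y, ‖Φ y‖ ≤ 1) ∧
      (∀ y z, ‖Φ y - Φ z‖ ≤ (2 * Real.pi) * (Nilmanifold.circle.ofLE h12).dist y z) ∧
      ∀ n : ℤ, Φ (g ^ n • p₀) =
        Complex.exp (2 * Real.pi * Complex.I * ((x₀ + n * θ : ℝ) : ℂ)) := by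
  obtain ⟨Φ, g, p₀, hb, hL, horb⟩ := exists_circle_realisation
    (fun a => ((AddCircle.toCircle a : Circle) : ℂ)) (M := 2 * Real.pi)
    (fun a => by rw [Circle.norm_coe]) (fun a b => by
      rw [dist_eq_norm]; exact norm_toCircle_sub_toCircle_le a b) θ x₀ h12
  refine ⟨Φ, g, p₀, hb, hL, fun n => ?_⟩
  rw [horb n, AddCircle.toCircle_apply_mk, Circle.coe_exp]
  congr 1
  push_cast
  ring

end Summit.Parity.GeneralizedHardyLittlewood.GreenTaoLevelTwoGITwoCyclicInverse
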